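import Summits.BirchSwinnertonDyer.BirchSwinnertonDyer.Theorems.SignedLowerHalvesSmallImageLowerHalfBothSignsRttD2SeqSemilocPairLaws
import Summits.BirchSwinnertonDyer.BirchSwinnertonDyer.Theorems.SchneiderFreeAdditiveX3PoitouTateMiddleExactTools
import Literature.NumberTheory.GaloisRepresentations.ContinuousCupProductCompatMixed
import Literature.NumberTheory.GaloisRepresentations.LocalTatePairingLevelChange
import Literature.NumberTheory.GaloisRepresentations.LocalKummerTorsion
import HarnessLib

/-!
# Route `SignedLowerHalves`, crux L `SmallImageLowerHalfBothSigns` (stmt-BirchSwinnertonDyer-23599), line `rtt_w3` v30 — stub S3β″ (`stub_junctionPT_ns`, row J4′,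
# Poitou–Tate half), brick N2a/L2: THE LEVEL LAW `red ⊣ incl` OF THE SEMILOCAL LEVEL PAIRING `semilocPairNK` —
# `⟨semilocRed t, semilocDual c⟩_{w,n,k} / p^k = ⟨t, semilocDual (incl c)⟩_{w,n,k+1} / p^{k+1}` in `ℚ/ℤ`

WIDTH seat `bsd-line-slh-p3-w3` g26 under LEAD `cruxlead-stmt-BirchSwinnertonDyer-23599` g14 (cell `bsd-ssimc`); helper `--supports stmt-BirchSwinnertonDyer-23599`
(design memo `Lines/rtt_w3-DESIGN-S3beta-w3-g25.md`, rev 4 §6 RECIPE L2). TWO DEFINITIONS WITH BODIES (`torsInclHom`, the coefficient inclusion `M[p^k] ⊆ M[p^{k′}]` as a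
`Γ_K`-morphism; `tateDualTransposeIncl`, the level-raising transpose `F ↦ (μ_a ⊆ μ_N) ∘ F ∘ α` on Tate duals) + THEOREMS; no named fact, no instance, no `sorry`.
HONEST FRAMING: the fourth transition law of the semilocal tower pairing `Hloc_w × Sel(K_∞) → ℚ/ℤ` (brick N2 of S3β″) — the one that makes the layer pairing independent of the
torsion level `k` of the lift; nothing about S3β″, S3α′, crux L or BSD is proved; all remain OPEN and are proved for NO curve.

WHAT.
* §1 `torsInclHom h : M[p^k] ⟶ M[p^{k′}]` (`k ≤ k′`, the inclusion, `Γ_K`-equivariant), `cohomologyMap_subgroupRepMap_torsInclHom` (on `H¹(U_n, ·)` it IS the tree-side `torsIncl`,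
  definitional); `tateDualTransposeIncl ρ₁ ρ₂ haN α : (ρ₁^D_a) ⟶ (ρ₂^D_N)`, `F ↦ (μ_a ⊆ μ_N) ∘ F ∘ α` for `α : ρ₂ ⟶ ρ₁`, `a ∣ N`.
* §2 `canonical_cohomologyMap_muInclHom` — the level-change law of THE invariant maps `inv_w^{(p^{k+1})}((μ_{p^k} ⊆ μ_{p^{k+1}})_* z) = p · inv_w^{(p^k)}(z)` (Serre XIII §3 Cor. 3;
  the tree's `PoitouTateReduction.canonical_map_muIncl`) read in honda's `TopRep.res res_w` dialect of T1-a.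
* §3 ★★ `semilocPairNK_semilocRed` (L2, `ℤ/p^{k+1}`-valued: `⟨t, semilocDual (incl c)⟩_{n,k+1} = p · ⟨semilocRed t, semilocDual c⟩_{n,k}`) and ★★ `zmodToQmodZ_semilocPairNK_semilocRed` /
  `zmodToQmodZ_semilocPairNK_torsIncl` (the `ℚ/ℤ` form, tree-side `torsIncl` currency), GIVEN the level compatibility `hPred` of honda's coefficient pairings
  `P_{k+1}(x, incl m) = (μ_{p^k} ⊆ μ_{p^{k+1}})(P_k(red x, m))` (g23's `cofreeLamCoeffPairingK_hPred` discharges it for the LEAD's `M = Cofree θ F`). Proof: the transpose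
  `redᴰ = tateDualTransposeIncl … (Maps(red))` satisfies the module identity `redᴰ ∘ Ψ_k = Ψ_{k+1} ∘ Maps(incl)` (`hPred` termwise), `Sh_{U_n}(incl c) = H¹(Maps(incl))(Sh_{U_n} c)`
  (`shapiroLift_cohomologyMap`), `res_w` is natural, the MIXED-variance naturality of the cup product `H²(μ-incl)(H¹(Maps(red)) t ∪_k b) = t ∪_{k+1} H¹(redᴰ) b`
  (`ContPairing.cupProduct_map_adjoint`), and §2.
References: [NeukirchSchmidtWingberg2008] I §4 (1.4.2), (7.1.4), (7.2.6), (8.6.2); [SerreLocalFields1979] XIII §3 Cor. 3; [MilneADT2006] I Cor. 2.3; [Rubin2000] §4.2, App. B.2;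
[Greenberg2010] §3.1 (9).
-/

set_option autoImplicit false
set_option linter.dupNamespace false -- D-0017: single-problem summit, the namespace repeats the problem name by design
noncomputable section

open scoped Classical
open CategoryTheory Function NumberField IsDedekindDomain Field

namespace Summit.BirchSwinnertonDyer.BirchSwinnertonDyer.Theorems.SmallImageRttD2Seq

open Literature.NumberTheory.GaloisRepresentations Literature.NumberTheory.GaloisCohomology Literature.NumberTheory.EllipticCurves
  Literature.NumberTheory.ComplexMultiplication.EllipticUnits Literature.NumberTheory.ComplexMultiplication.EllipticUnits.JohnsonLeungKings2011
  Literature.NumberTheory.GaloisRepresentations.DiscreteGaloisModule Literature.NumberTheory.GaloisCohomology.PoitouTateFinite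
  Literature.AnabelianGeometry.AbsoluteAnabelian.Prop121vii
  Summit.BirchSwinnertonDyer.BirchSwinnertonDyer.Theorems.SmallImageRttD2J1
  Summit.BirchSwinnertonDyer.BirchSwinnertonDyer.Theorems.SchneiderFreeAdditiveX3

/-! ## §1. The coefficient inclusion `M[p^k] ⊆ M[p^{k′}]` as a `Γ_K`-morphism, and the level-raising transpose on Tate duals -/

section TorsIncl

variable {G : Type} [Group G] [TopologicalSpace G] [IsTopologicalGroup G]
  (M : Type) [AddCommGroup M] [TopologicalSpace M] [DiscreteTopology M] [DistribMulAction G M]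
  (hstab : ∀ m : M, IsOpen (MulAction.stabilizer G m : Set G)) (p : ℕ)

/-- **The inclusion of coefficients `M[p^k] ⊆ M[p^{k′}]` (`k ≤ k′`) as a morphism of the continuous representations `torsRep`** (it commutes with `G`). [cite: Rubin2000, §4.2] -/
def torsInclHom {k k' : ℕ} (h : k ≤ k') : (torsRep M hstab p k).toTopRep ⟶ (torsRep M hstab p k').toTopRep :=
  TopRep.ofHom
    { toContinuousLinearMap :=
        { toLinearMap := (AddSubgroup.inclusion (torsionPow_mono (M := M) (p := p) h)).toIntLinearMap
          cont := continuous_of_discreteTopology }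
      isIntertwining' := fun _ => by
        ext m : 1
        rfl }

/-- Values of `torsInclHom`. [folklore] -/
@[simp] theorem torsInclHom_hom_apply {k k' : ℕ} (h : k ≤ k') (m : ↥(torsionPow M p k)) :
    (torsInclHom M hstab p h).hom m = AddSubgroup.inclusion (torsionPow_mono (M := M) (p := p) h) m :=
  rfl

/-- On `H¹(U, ·)` the morphism `torsInclHom` induces the tree-side `torsIncl` (the two cohomology dialects agree definitionally, cf. `resLe_torsRep_eq_resOfLe`). [folklore] -/
theorem cohomologyMap_subgroupRepMap_torsInclHom (U : Subgroup G) {k k' : ℕ} (h : k ≤ k')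
    (c : continuousCohomology 1 (subgroupRep (torsRep M hstab p k).toTopRep U)) :
    cohomologyMap (subgroupRepMap (torsInclHom M hstab p h) U) 1 c = torsIncl M p U h c :=
  rfl

end TorsIncl

section TransposeIncl

variable {K : Type} [Field K] [NumberField K] {M₁ M₂ : Type} [AddCommGroup M₁] [TopologicalSpace M₁] [DiscreteTopology M₁] [Finite M₁]
  [AddCommGroup M₂] [TopologicalSpace M₂] [DiscreteTopology M₂] [Finite M₂]
  (ρ₁ : DiscreteGaloisModule K M₁) (ρ₂ : DiscreteGaloisModule K M₂) {a N : ℕ} (haN : a ∣ N)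

/-- **The level-raising transpose `αᴰ : M₁^D_a → M₂^D_N`, `F ↦ (μ_a ⊆ μ_N) ∘ F ∘ α`, of a `Γ_K`-morphism `α : M₂ → M₁`** (`a ∣ N`), as a morphism of the topological representations
underlying the Tate duals `Hom(M₁, μ_a)`, `Hom(M₂, μ_N)` (equivariant because `α` commutes with `σ⁻¹` and `μ_a ⊆ μ_N` with `σ`). The dual transition of the coefficient tower behind
`lim_k H¹(K_w, X_k)` / `colim_k H¹(U_n, M[p^k])`. [cite: MilneADT2006, Ch. I §0, Cor. 2.3] [cite: NeukirchSchmidtWingberg2008, (7.1.4)] -/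
def tateDualTransposeIncl (α : ρ₂.toTopRep ⟶ ρ₁.toTopRep) : (ρ₁.tateDual a).toTopRep ⟶ (ρ₂.tateDual N).toTopRep :=
  TopRep.ofHom
    { toContinuousLinearMap :=
        { toLinearMap := (((AddMonoidHom.compHom (muInclusion K haN)).comp (AddMonoidHom.compHom' (α.hom.toLinearMap.toAddMonoidHom)) :
              (M₁ →+ MuCarrier K a) →+ (M₂ →+ MuCarrier K N))).toIntLinearMap
          cont := continuous_of_discreteTopology }
      isIntertwining' := fun σ => by
        ext F : 1
        refine TateDual.ext fun m => ?_
        change muInclusion K haN (mu K a σ (F (ρ₁ σ⁻¹ (α.hom m)))) = mu K N σ (muInclusion K haN (F (α.hom (ρ₂ σ⁻¹ m))))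
        rw [ContinuousRep.hom_comm_apply α σ⁻¹ m]
        exact TopRep.hom_comm_apply (muInclHom K haN) σ _ }

omit [NumberField K] in
/-- Values of the level-raising transpose: `(αᴰ F) m = (μ_a ⊆ μ_N)(F (α m))`. [folklore] -/
@[simp] theorem tateDualTransposeIncl_hom_apply (α : ρ₂.toTopRep ⟶ ρ₁.toTopRep) (F : TateDual K M₁ a) (m : M₂) :
    ((tateDualTransposeIncl ρ₁ ρ₂ haN α).hom F : TateDual K M₂ N) m = muInclusion K haN (F (α.hom m)) :=
  rfl

end TransposeIncl

/-! ## §2. Level change of THE invariant maps in honda's dialect -/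

section Canonical

variable {K : Type} [Field K] [NumberField K] (w : HeightOneSpectrum (𝓞 K)) {a N : ℕ} [NeZero a] [NeZero N] (haN : a ∣ N)

-- honda's tower speaks `H²(Γ_{K_w}, TopRep.res res_w μ_a)` / `cohomologyMap ((resFunctor res_w).map (muInclHom K haN))`, the base-field Poitou–Tate package speaks
-- `galoisCohomology ((mu K a).toLocal (Sum.inr w)) 2` / `galoisCohomology.map (j.restrictField _)`: DEFINITIONALLY equal dialects (`Place.Completion (Sum.inr w)` and
-- `absGaloisRestrict` unfold to `w.adicCompletion K` and `resGalOfEmb (closureEmb …)`); the identification is paid once here.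
set_option maxHeartbeats 2000000 in
/-- **Level change of THE invariant maps on semilocal classes, honda's dialect**: `inv_w^{(N)}((μ_a ⊆ μ_N)_* z) = (N/a) · inv_w^{(a)}(z)` in `ℤ/N` for every `z ∈ H²(Γ_{K_w}, μ_a)`
(`PoitouTateReduction.canonical_map_muIncl`; `muInclHom` IS the `TopRep` morphism of the intertwining map `μ_a ⊆ μ_N`, by extensionality).
[cite: SerreLocalFields1979, XIII §3 Cor. 3] [cite: MilneADT2006, Ch. I, Ex. 1.6 (c)] -/
theorem canonical_cohomologyMap_muInclHom
    (z : continuousCohomology 2 (TopRep.res (resGalOfEmb (closureEmb (K := K) (w.adicCompletion K)) : absoluteGaloisGroup (w.adicCompletion K) →* absoluteGaloisGroup K)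
      (mu K a).toTopRep)) :
    LocalInvariants.canonical K N (Sum.inr w)
        (cohomologyMap ((TopRep.resFunctor (resGalOfEmb (closureEmb (K := K) (w.adicCompletion K)) :
          absoluteGaloisGroup (w.adicCompletion K) →* absoluteGaloisGroup K)).map (muInclHom K haN)) 2 z) =
      (((LocalInvariants.canonical K a (Sum.inr w) z).val * (N / a) : ℕ) : ZMod N) := by
  obtain ⟨j, hj⟩ := PoitouTateReduction.exists_muIncl_intertwining K haN
  have hmor : muInclHom K haN = DiscreteGaloisModule.homOfIntertwining j :=
    TopRep.hom_ext (ContIntertwiningMap.ext (ContinuousLinearMap.ext fun v ↦ (hj v).symm))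
  rw [hmor]
  exact PoitouTateReduction.canonical_map_muIncl haN j hj (Sum.inr w) z

end Canonical

/-! ## §3. The level law `red ⊣ incl` -/

section Red

variable {K : Type} [Field K] [NumberField K] {p : ℕ} [Fact p.Prime] (S : Set (PadicAlgCl p)) [FiniteDimensional ℚ_[p] (padicCoeffField S)] (κ : ZpExtension K p)
  (θ' : absoluteGaloisGroup K →ₜ* (padicCoeffIntegers S)ˣ) (P : Set (HeightOneSpectrum (𝓞 K)))
  (M : Type) [AddCommGroup M] [TopologicalSpace M] [DiscreteTopology M] [DistribMulAction (absoluteGaloisGroup K) M]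
  (hstabK : ∀ m : M, IsOpen (MulAction.stabilizer (absoluteGaloisGroup K) m : Set (absoluteGaloisGroup K)))
  (PG : ∀ k : ℕ, ContPairing (coeffRepK S θ' P k).toTopRep (torsRep M hstabK p k).toTopRep (mu K (p ^ k)).toTopRep)
  (hPred : ∀ (k : ℕ) (x : ↥(Representation.invariants ((muTwistO S θ' (k + 1)).toRepresentation.comp (ramificationSubgroup K P).subtype))) (m : ↥(torsionPow M p k)),
    (PG (k + 1)).toLin x (AddSubgroup.inclusion (torsionPow_mono (M := M) (p := p) (Nat.le_succ k)) m) =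
      muInclusion K (pow_dvd_pow p (Nat.le_succ k)) ((PG k).toLin (coeffMapO S P θ' (oMuRed S k) (oMuRed_muTwistO S θ' k) x) m))
  (w : HeightOneSpectrum (𝓞 K))

include hPred in
set_option maxHeartbeats 2000000 in
/-- ★★ **L2 — `red ⊣ incl`, `ℤ/p^{k+1}`-valued.** For `t ∈ Lloc_w(n,k+1) = H¹(K_w, Maps(Γ_K ⧸ U_n, X_{k+1}))` and a global layer class `c ∈ H¹(U_n, M[p^k])`:
`⟨t, semilocDual (incl c)⟩_{w,n,k+1} = p · ⟨semilocRed t, semilocDual c⟩_{w,n,k}` (the value at level `k+1` is the level-`k` value pushed along `ℤ/p^k ↪ ℤ/p^{k+1}`), GIVEN the level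
compatibility `hPred` of honda's coefficient pairings. Proof: with `α = Maps(red) : Maps(Γ_K ⧸ U_n, X_{k+1}) → Maps(Γ_K ⧸ U_n, X_k)`, `β = Maps(incl)` on the A-side and the level-raising
transpose `αᴰ = (μ-incl) ∘ (·) ∘ α`: `αᴰ ∘ Ψ_k = Ψ_{k+1} ∘ β` termwise (`hPred`), `Sh_{U_n}(incl c) = H¹(β)(Sh_{U_n} c)`, `res_w` natural, the mixed-variance cup-product naturality
`H²(μ-incl)(H¹(α|_w) t ∪_k b) = t ∪_{k+1} H¹(αᴰ|_w) b` for the evaluation pairings, and the level change of the canonical invariants (§2). [cite: NeukirchSchmidtWingberg2008, I §4 (1.4.2), (7.1.4), (7.2.6)]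
[cite: SerreLocalFields1979, XIII §3 Cor. 3] [cite: MilneADT2006, Ch. I, Cor. 2.3] [cite: Rubin2000, §4.2] -/
theorem semilocPairNK_semilocRed (n k : ℕ) (t : semilocCoh S κ θ' P w n (k + 1) 1)
    (c : continuousCohomology 1 (subgroupRep (torsRep M hstabK p k).toTopRep (κ.layerSubgroup n))) :
    semilocPairNK S κ θ' P M hstabK PG w n (k + 1) t (cohomologyMap (subgroupRepMap (torsInclHom M hstabK p (Nat.le_succ k)) (κ.layerSubgroup n)) 1 c) =
      (((semilocPairNK S κ θ' P M hstabK PG w n k (semilocRed S κ θ' P w n k 1 t) c).val * (p ^ (k + 1) / p ^ k) : ℕ) : ZMod (p ^ (k + 1))) := by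
  letI := layerQuotFintype κ n
  haveI := finite_oMuCarrier (K := K) S k
  haveI := finite_oMuCarrier (K := K) S (k + 1)
  haveI : NeZero (p ^ k) := ⟨pow_ne_zero _ (Fact.out : p.Prime).ne_zero⟩
  haveI : NeZero (p ^ (k + 1)) := ⟨pow_ne_zero _ (Fact.out : p.Prime).ne_zero⟩
  haveI : CompactSpace (absoluteGaloisGroup (w.adicCompletion K)) := absoluteGaloisGroup_compactSpace _
  have hdiv : p ^ k ∣ p ^ (k + 1) := pow_dvd_pow p (Nat.le_succ k)
  -- the coinduced X-modules at the two levels, their duality morphisms `Ψ`, the reduction `α`, the inclusion `β`, and the level-raising transpose `αᴰ`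
  set ρ : DiscreteGaloisModule K (absoluteGaloisGroup K ⧸ κ.layerSubgroup n → ↥(Representation.invariants ((muTwistO S θ' k).toRepresentation.comp (ramificationSubgroup K P).subtype))) :=
    DiscreteGaloisModule.coind (coeffRepK S θ' P k) (κ.layerSubgroup n) (κ.isOpen_layerSubgroup n) with hρ
  set ρ' : DiscreteGaloisModule K (absoluteGaloisGroup K ⧸ κ.layerSubgroup n → ↥(Representation.invariants ((muTwistO S θ' (k + 1)).toRepresentation.comp (ramificationSubgroup K P).subtype))) :=
    DiscreteGaloisModule.coind (coeffRepK S θ' P (k + 1)) (κ.layerSubgroup n) (κ.isOpen_layerSubgroup n) with hρ'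
  set Ψ := coindTateDualMor (coeffRepK S θ' P k) (torsRep M hstabK p k) (κ.layerSubgroup n) (pairingB S θ' P M hstabK PG k)
    (κ.isOpen_layerSubgroup n) (pairingB_smul S θ' P M hstabK PG k) with hΨ
  set Ψ' := coindTateDualMor (coeffRepK S θ' P (k + 1)) (torsRep M hstabK p (k + 1)) (κ.layerSubgroup n) (pairingB S θ' P M hstabK PG (k + 1))
    (κ.isOpen_layerSubgroup n) (pairingB_smul S θ' P M hstabK PG (k + 1)) with hΨ'
  set α : coindFin.{0, 0} (coeffRepK S θ' P (k + 1)).toTopRep (κ.layerSubgroup n) ⟶ coindFin.{0, 0} (coeffRepK S θ' P k).toTopRep (κ.layerSubgroup n) :=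
    coindFinMap (coeffHomK S θ' P (oMuRed S k) (oMuRed_muTwistO S θ' k)) (κ.layerSubgroup n) with hα
  set β : coindFin.{0, 0} (torsRep M hstabK p k).toTopRep (κ.layerSubgroup n) ⟶ coindFin.{0, 0} (torsRep M hstabK p (k + 1)).toTopRep (κ.layerSubgroup n) :=
    coindFinMap (torsInclHom M hstabK p (Nat.le_succ k)) (κ.layerSubgroup n) with hβ
  set αD : (ρ.tateDual (p ^ k)).toTopRep ⟶ (ρ'.tateDual (p ^ (k + 1))).toTopRep := tateDualTransposeIncl ρ ρ' hdiv α with hαD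
  -- (1) the module identity `αᴰ ∘ Ψ_k = Ψ_{k+1} ∘ β` (termwise `hPred`), on classes
  have hmod : ∀ ψ : coindFin.{0, 0} (torsRep M hstabK p k).toTopRep (κ.layerSubgroup n), αD.hom (Ψ.hom ψ) = Ψ'.hom (β.hom ψ) := fun ψ ↦ by
    refine TateDual.ext fun φ ↦ ?_
    rw [hαD, tateDualTransposeIncl_hom_apply, hΨ, hΨ', coindTateDualMor_hom_apply, coindTateDualMor_hom_apply, coindTateDualHom_apply_apply,
      coindTateDualHom_apply_apply, map_sum]
    refine Finset.sum_congr rfl fun y _ ↦ ?_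
    rw [hα, hβ]
    exact (hPred k (φ y) (ψ y)).symm
  have hglob : ∀ z : continuousCohomology 1 (coindFin.{0, 0} (torsRep M hstabK p k).toTopRep (κ.layerSubgroup n)),
      cohomologyMap αD 1 (cohomologyMap Ψ 1 z) = cohomologyMap Ψ' 1 (cohomologyMap β 1 z) := fun z ↦ by
    have e1 := map_comp_apply_of (ContinuousMonoidHom.id (absoluteGaloisGroup K)) (ContinuousMonoidHom.id (absoluteGaloisGroup K))
      (ContinuousMonoidHom.id (absoluteGaloisGroup K)) (fun _ ↦ rfl) (resIdHom Ψ) (resIdHom αD) (resIdHom (β ≫ Ψ')) (fun v ↦ (hmod v).symm) 1 z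
    have e2 := map_comp_apply_of (ContinuousMonoidHom.id (absoluteGaloisGroup K)) (ContinuousMonoidHom.id (absoluteGaloisGroup K))
      (ContinuousMonoidHom.id (absoluteGaloisGroup K)) (fun _ ↦ rfl) (resIdHom β) (resIdHom Ψ') (resIdHom (β ≫ Ψ')) (fun _ ↦ rfl) 1 z
    exact e1.symm.trans e2
  -- (2) `Sh_{U_n}(incl c) = H¹(β)(Sh_{U_n} c)`
  have hSh : shapiroLift (torsRep M hstabK p (k + 1)).toTopRep (κ.layerSubgroup n) (κ.isOpen_layerSubgroup n) (layerReps_spec κ n) (layerReps_one κ n)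
        (cohomologyMap (subgroupRepMap (torsInclHom M hstabK p (Nat.le_succ k)) (κ.layerSubgroup n)) 1 c) =
      cohomologyMap β 1 (shapiroLift (torsRep M hstabK p k).toTopRep (κ.layerSubgroup n) (κ.isOpen_layerSubgroup n) (layerReps_spec κ n) (layerReps_one κ n) c) := by
    rw [hβ, shapiroLift_cohomologyMap]
  -- (3) naturality of `res_w` on the dual side
  have hloc : ∀ z : continuousCohomology 1 (ρ.tateDual (p ^ k)).toTopRep,
      semilocDualRes S κ θ' P w n (k + 1) (cohomologyMap αD 1 z) =
        cohomologyMap ((TopRep.resFunctor (resGalOfEmb (closureEmb (K := K) (w.adicCompletion K)) :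
          absoluteGaloisGroup (w.adicCompletion K) →* absoluteGaloisGroup K)).map αD) 1 (semilocDualRes S κ θ' P w n k z) := fun z ↦ by
    rw [semilocDualRes_apply, semilocDualRes_apply, map_cohomologyMap_eq_map, Category.comp_id, cohomologyMap_map_id_eq_map]
  -- (4) mixed-variance naturality of the cup product at `Γ_{K_w}` for `(α|_w, αᴰ|_w, μ-incl|_w)` under the evaluation pairings
  have hcup : ∀ (a : semilocCoh S κ θ' P w n (k + 1) 1) (b : continuousCohomology 1 (semilocDualRep S κ θ' P w n k)),
      cohomologyMap ((TopRep.resFunctor (resGalOfEmb (closureEmb (K := K) (w.adicCompletion K)) :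
          absoluteGaloisGroup (w.adicCompletion K) →* absoluteGaloisGroup K)).map (muInclHom K hdiv)) 2
        ((semilocEvalPairing S κ θ' P w n k).cupProduct (semilocRed S κ θ' P w n k 1 a) b) =
      (semilocEvalPairing S κ θ' P w n (k + 1)).cupProduct a
        (cohomologyMap ((TopRep.resFunctor (resGalOfEmb (closureEmb (K := K) (w.adicCompletion K)) :
          absoluteGaloisGroup (w.adicCompletion K) →* absoluteGaloisGroup K)).map αD) 1 b) := fun a b ↦ by
    rw [show semilocRed S κ θ' P w n k 1 a = semilocH S κ θ' P w α 1 a from rfl, semilocH_apply]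
    exact ContPairing.cupProduct_map_adjoint (semilocEvalPairing S κ θ' P w n k) (semilocEvalPairing S κ θ' P w n (k + 1))
      ((TopRep.resFunctor (resGalOfEmb (closureEmb (K := K) (w.adicCompletion K)) : absoluteGaloisGroup (w.adicCompletion K) →* absoluteGaloisGroup K)).map α)
      ((TopRep.resFunctor (resGalOfEmb (closureEmb (K := K) (w.adicCompletion K)) : absoluteGaloisGroup (w.adicCompletion K) →* absoluteGaloisGroup K)).map αD)
      ((TopRep.resFunctor (resGalOfEmb (closureEmb (K := K) (w.adicCompletion K)) : absoluteGaloisGroup (w.adicCompletion K) →* absoluteGaloisGroup K)).map (muInclHom K hdiv))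
      (fun _ _ ↦ rfl) a b
  -- assemble
  rw [semilocPairNK_eq_canonical_cupProduct, semilocPairNK_eq_canonical_cupProduct, hSh, ← hglob, hloc, ← hcup,
    canonical_cohomologyMap_muInclHom w hdiv]

include hPred in
/-- ★★ **L2 in `ℚ/ℤ`**: `⟨t, semilocDual (incl c)⟩_{w,n,k+1} / p^{k+1} = ⟨semilocRed t, semilocDual c⟩_{w,n,k} / p^k` — the semilocal level pairings read in `ℚ/ℤ` are COMPATIBLE along the
coefficient tower (the `red ⊣ incl` law of the four laws of brick N2a; with L1/L3/L4 of `…SemilocPairLaws` the list is complete). [cite: NeukirchSchmidtWingberg2008, (7.1.4), (7.2.6)]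
[cite: SerreLocalFields1979, XIII §3 Cor. 3] [cite: Greenberg2010, §3.1 (9)] [cite: Rubin2000, §4.2, App. B.2] -/
theorem zmodToQmodZ_semilocPairNK_semilocRed (n k : ℕ) (t : semilocCoh S κ θ' P w n (k + 1) 1)
    (c : continuousCohomology 1 (subgroupRep (torsRep M hstabK p k).toTopRep (κ.layerSubgroup n))) :
    haveI : NeZero (p ^ k) := ⟨pow_ne_zero _ (Fact.out : p.Prime).ne_zero⟩
    haveI : NeZero (p ^ (k + 1)) := ⟨pow_ne_zero _ (Fact.out : p.Prime).ne_zero⟩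
    zmodToQmodZ (p ^ (k + 1)) (semilocPairNK S κ θ' P M hstabK PG w n (k + 1) t
        (cohomologyMap (subgroupRepMap (torsInclHom M hstabK p (Nat.le_succ k)) (κ.layerSubgroup n)) 1 c)) =
      zmodToQmodZ (p ^ k) (semilocPairNK S κ θ' P M hstabK PG w n k (semilocRed S κ θ' P w n k 1 t) c) := by
  haveI : NeZero (p ^ k) := ⟨pow_ne_zero _ (Fact.out : p.Prime).ne_zero⟩
  haveI : NeZero (p ^ (k + 1)) := ⟨pow_ne_zero _ (Fact.out : p.Prime).ne_zero⟩
  rw [semilocPairNK_semilocRed S κ θ' P M hstabK PG hPred w n k t c]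
  exact zmodToQmodZ_natCast_val_mul_div (pow_dvd_pow p (Nat.le_succ k)) _

include hPred in
/-- ★★ **L2 in the tree-side currency** (`torsIncl` on `subgroupH1 (κ.layerSubgroup n) M[p^k]`, the dialect of `…J3TorsionLevels`; definitionally the same statement):
`⟨t, semilocDual (torsIncl c)⟩_{w,n,k+1} / p^{k+1} = ⟨semilocRed t, semilocDual c⟩_{w,n,k} / p^k`. [cite: NeukirchSchmidtWingberg2008, (7.1.4), (7.2.6)] [cite: SerreLocalFields1979, XIII §3 Cor. 3]
[cite: Rubin2000, §4.2, App. B.2] -/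
theorem zmodToQmodZ_semilocPairNK_torsIncl (n k : ℕ) (t : semilocCoh S κ θ' P w n (k + 1) 1) (c : subgroupH1 (κ.layerSubgroup n) ↥(torsionPow M p k)) :
    haveI : NeZero (p ^ k) := ⟨pow_ne_zero _ (Fact.out : p.Prime).ne_zero⟩
    haveI : NeZero (p ^ (k + 1)) := ⟨pow_ne_zero _ (Fact.out : p.Prime).ne_zero⟩
    zmodToQmodZ (p ^ (k + 1)) (semilocPairNK S κ θ' P M hstabK PG w n (k + 1) t (torsIncl M p (κ.layerSubgroup n) (Nat.le_succ k) c)) =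
      zmodToQmodZ (p ^ k) (semilocPairNK S κ θ' P M hstabK PG w n k (semilocRed S κ θ' P w n k 1 t) c) :=
  zmodToQmodZ_semilocPairNK_semilocRed S κ θ' P M hstabK PG hPred w n k t c

end Red

end Summit.BirchSwinnertonDyer.BirchSwinnertonDyer.Theorems.SmallImageRttD2Seq

end
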